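import Literature.NumberTheory.EllipticCurves.ModPReducibilityProofs
import Literature.NumberTheory.EllipticCurves.MazurTorsionGaloisStructureProofs
import Literature.NumberTheory.EllipticCurves.OpenImageMazurAssemblyProofs
import Literature.NumberTheory.EllipticCurves.LFunctionPrimeCoeff
import Literature.NumberTheory.EllipticCurves.RootNumberSmulProofs
import Literature.NumberTheory.EllipticCurves.GlobalMinimalModelProofs
import Literature.NumberTheory.DiophantineGeometry.ConductorExponentZeroProofs
import Literature.NumberTheory.DiophantineGeometry.ConductorFactorizationProofs
import HarnessLib

/-!
# A good prime `ℓ ∤ p N_E` with non-Eisenstein trace `a_ℓ(E) ≢ ℓ + 1 (mod p)`, from surjectivity of `ρ̄_{E,p}`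

Topic `NumberTheory/EllipticCurves`; theorems only (no definition, no named fact, no instance).
The Galois-theoretic input of the "`𝔪_f` non-Eisenstein" step in Pollack–Weston 2011 (proof of
Thm. 6.8 through Prop. 6.3 (2) / 6.4 (1): under hypothesis CR (i), `ρ̄_f` surjective, the maximal
ideal `𝔪_f = (p, T_ℓ - a_ℓ)` is not Eisenstein, i.e. `a_ℓ ≢ ℓ + 1 (mod p)` for some good `ℓ`),
stated for an elliptic curve `E/ℚ` given by an ARBITRARY Weierstrass model `W` and for the
coefficients `a_ℓ(E) = W.LFunction ℓ` of Mathlib's `WeierstrassCurve.LFunction`, the form consumed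
on the Brandt-module side (`Brandt.eigenLattice … (fun n => W.LFunction n)` in
`PollackWeston2011.thm_6_8_ellipticCurve`, `takahashi2001_thm_2_3`).

Everything here is assembly of results already PROVED in the tree:
* `not_irreducible_of_frobeniusTrace_congr_holds` (`ModPReducibilityProofs`: Chebotarev for
  division fields + reduction of torsion; Darmon–Diamond–Taylor 1995 Prop. 2.6(b), Katz 1981
  Thm. 2): `a_ℓ ≡ ℓ + 1 (mod p)` at all good `ℓ ≠ p` forces `E[p]` reducible — for a GLOBALLY
  MINIMAL model and the tree's `frobeniusTrace`;
* the bridges `LFunction_apply_prime_eq_frobeniusTrace` (Silverman AEC Ex. 8.19(a)),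
  `LFunction_smul`, `conductorNorm_smul` (model invariance), `hasGlobalMinimalModel_rat_holds`
  (Néron; AEC VIII.8.3), `Mazur1978.hasIrreducibleModPGaloisRep_smul_iff`,
  `conductorExponent_eq_zero_iff_holds` + `factorization_conductorNorm_holds` +
  `hasGoodReductionAtPrime_iff_hasGoodReductionAt_holds` (`f_ℓ = 0` iff good reduction, so a good
  `ℓ` does not divide `N_E`; Silverman ATAEC IV.10.2(a), AEC C.16).

## Contents (namespace `Literature.NumberTheory.EllipticCurves`)

* `hasIrreducibleModPGaloisRep_of_hasSurjectiveModNGaloisRep` — **surjective ⇒ irreducible** for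
  the mod-`p` representation of an elliptic curve over any field `F` with `p ∈ Fˣ`: a proper
  non-zero `Γ_F`-stable subgroup `H ⊂ E[p] ≅ 𝔽_p²` would be stable under ALL of
  `Aut(E[p]) = ρ̄(Γ_F)`, but the coordinate swap of a frame through `P ∈ H ∖ 0`
  (`exists_addEquiv_apply_eq_single`) moves `P` to an independent point. (Serre 1972 §4: CR (i)
  of Pollack–Weston is stated as surjectivity; irreducibility is what the Eisenstein step uses.)
* `not_dvd_conductorNorm_of_hasGoodReductionAtPrime` — a prime of good reduction of a globally
  minimal `W/ℚ` does not divide the conductor `N_E` (`f_ℓ = 0`).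
* `exists_prime_not_dvd_lFunction_sub_of_hasIrreducibleModPGaloisRep`,
  `exists_prime_not_dvd_lFunction_sub_of_hasSurjectiveModNGaloisRep` — **for `E[p]` irreducible
  (resp. `ρ̄_{E,p}` surjective) there is a prime `ℓ ≠ p`, `ℓ ∤ N_E`, with
  `a_ℓ(E) ≢ ℓ + 1 (mod p)`**, `a_ℓ(E) = W.LFunction ℓ`, for any model `W` of `E`.

## References

* [PollackWeston2011] R. Pollack, T. Weston, Compositio Math. 147 (2011), Introduction
  (hypothesis CR) and §6.2 (localisation at `𝔪_f`).
* [DarmonDiamondTaylor1995] H. Darmon, F. Diamond, R. Taylor, Fermat's Last Theorem (1995),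
  Prop. 2.6(b), 2.8(a), 2.11(a).
* [Serre1972] J.-P. Serre, Invent. Math. 15 (1972), §4.
* [SilvermanAEC2009] J. H. Silverman, AEC, 2nd ed., VII.5.1(a), VIII.8.3, Ex. 8.19(a), C.16.
-/

noncomputable section

open scoped Classical

open NumberField IsDedekindDomain WeierstrassCurve Field

universe u

namespace Literature.NumberTheory.EllipticCurves

/-! ### Surjective `⇒` irreducible -/

/-- **A surjective mod-`p` representation is irreducible.** For an elliptic curve over a field
`F` with `p ≠ 0` in `F` (`E[p] ≅ (ℤ/p)²`): if `ρ̄_{E,p} : Γ_F → Aut(E[p])` is surjective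
(`HasSurjectiveModNGaloisRep`), the only `Γ_F`-stable subgroups of `E[p]` are `⊥` and `⊤`
(`HasIrreducibleModPGaloisRep`). Proof: a `Γ_F`-stable subgroup is stable under every additive
automorphism; for `P ∈ H ∖ 0` choose a frame `e : E[p] ≃ (ℤ/p)²` with `e P = (1, 0)`
(`exists_addEquiv_apply_eq_single`); the coordinate swap sends `P` to `Q = e⁻¹(0, 1) ∈ H`, and
`P, Q` generate `E[p]`. (Serre 1972, §4; hypothesis CR (i) of Pollack–Weston 2011.) [folklore] -/
theorem hasIrreducibleModPGaloisRep_of_hasSurjectiveModNGaloisRep {F : Type u} [Field F]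
    (W : WeierstrassCurve F) [W.IsElliptic] (p : ℕ) [Fact p.Prime] [NeZero (p : F)]
    (h : W.HasSurjectiveModNGaloisRep (p : ℤ)) : W.HasIrreducibleModPGaloisRep p := by
  intro H hH
  by_cases hbot : H = ⊥
  · exact Or.inl hbot
  right
  obtain ⟨P, hPH, hP0⟩ : ∃ P ∈ H, P ≠ 0 := by
    by_contra hne
    push Not at hne
    exact hbot ((AddSubgroup.eq_bot_iff_forall H).mpr hne)
  obtain ⟨e, he⟩ := exists_addEquiv_apply_eq_single W p hP0
  -- the coordinate swap of the frame, as an automorphism of `E[p]`, is some `ρ̄(σ)`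
  let s : (Fin 2 → ZMod p) ≃+ (Fin 2 → ZMod p) :=
    (LinearEquiv.funCongrLeft (ZMod p) (ZMod p) (Equiv.swap (0 : Fin 2) 1)).toAddEquiv
  have hs : ∀ (x : Fin 2 → ZMod p) (i : Fin 2), s x i = x (Equiv.swap (0 : Fin 2) 1 i) :=
    fun x i => rfl
  let φ : geomTorsion W p ≃+ geomTorsion W p := e.trans (s.trans e.symm)
  obtain ⟨σ, hσ⟩ := h (Multiplicative.ofAdd φ)
  set Q : geomTorsion W p := e.symm (Pi.single 1 1) with hQ_def
  have hsP : s (Pi.single 0 1) = Pi.single 1 1 := by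
    funext i
    rw [hs]
    fin_cases i <;> simp [Equiv.swap_apply_left, Equiv.swap_apply_right]
  have hσP : σ • P = Q := by
    have h1 : (galoisRepTorsion W (p : ℤ) σ).toAdd P = σ • P := galoisRepTorsion_apply W p σ P
    rw [← h1, hσ]
    change e.symm (s (e P)) = Q
    rw [he, hsP]
  have hQH : Q ∈ H := hσP ▸ hH σ P hPH
  -- `P` and `Q` generate `E[p]`
  rw [eq_top_iff]
  intro x _
  haveI : NeZero p := ⟨(Fact.out : p.Prime).ne_zero⟩
  have hx : x = (e x 0).val • P + (e x 1).val • Q := by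
    apply e.injective
    rw [map_add, map_nsmul, map_nsmul, he, hQ_def, AddEquiv.apply_symm_apply]
    funext i
    simp only [Pi.add_apply, Pi.smul_apply, Pi.single_apply, smul_ite, smul_zero]
    fin_cases i <;> simp
  rw [hx]
  exact H.add_mem (H.nsmul_mem hPH _) (H.nsmul_mem hQH _)

/-! ### Good primes do not divide the conductor -/

/-- **A prime of good reduction does not divide the conductor** `N_E` of a globally minimal
`W/ℚ`: `f_ℓ = 0` iff good reduction at the place of `ℓ` (Silverman ATAEC IV.10.2(a), tree
`conductorExponent_eq_zero_iff_holds`), `N_E = ∏ ℓ^{f_ℓ}` (`factorization_conductorNorm_holds`),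
and the prime-indexed and place-indexed good-reduction predicates agree
(`hasGoodReductionAtPrime_iff_hasGoodReductionAt_holds`). [cite: Silverman1994, IV.10.2(a)] -/
theorem not_dvd_conductorNorm_of_hasGoodReductionAtPrime (W : WeierstrassCurve ℚ) [W.IsElliptic]
    {ℓ : ℕ} [hℓ : Fact ℓ.Prime] (hgood : W.HasGoodReductionAtPrime ℓ) :
    ¬ ℓ ∣ W.conductorNorm ℤ := by
  set v : HeightOneSpectrum ℤ := (Rat.HeightOneSpectrum.primesEquiv (R := ℤ)).symm ⟨ℓ, hℓ.out⟩
    with hv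
  have hgood' : W.HasGoodReductionAt v :=
    (W.hasGoodReductionAtPrime_iff_hasGoodReductionAt_holds ⟨ℓ, hℓ.out⟩).mp hgood
  have hf : W.conductorExponent v = 0 := (conductorExponent_eq_zero_iff_holds v W).mpr hgood'
  have hgen : Rat.HeightOneSpectrum.natGenerator v = ℓ :=
    congrArg Subtype.val ((Rat.HeightOneSpectrum.primesEquiv (R := ℤ)).apply_symm_apply ⟨ℓ, hℓ.out⟩)
  have hfac : (W.conductorNorm ℤ).factorization ℓ = 0 := by
    rw [← hgen, W.factorization_conductorNorm_holds v, hf]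
  have hN : W.conductorNorm ℤ ≠ 0 := (W.conductorNorm_pos_holds).ne'
  rcases (Nat.factorization_eq_zero_iff _ _).mp hfac with h | h | h
  · exact absurd hℓ.out h
  · exact h
  · exact absurd h hN

/-! ### A good prime with non-Eisenstein trace, for any model -/

/-- **Irreducible `E[p]` gives a good prime `ℓ ∤ p N_E` with `a_ℓ(E) ≢ ℓ + 1 (mod p)`**, for the
coefficients `a_ℓ(E) = W.LFunction ℓ` of ANY Weierstrass model `W` of `E/ℚ`. Pass to a global
minimal model `W₀ = C • W` (`hasGlobalMinimalModel_rat_holds`; irreducibility, `L`-function and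
conductor are model invariants: `Mazur1978.hasIrreducibleModPGaloisRep_smul_iff`, `LFunction_smul`,
`conductorNorm_smul`), apply `exists_prime_not_dvd_frobeniusTrace_sub` with the PROVED fact
`not_irreducible_of_frobeniusTrace_congr_holds` (Chebotarev + Brauer–Nesbitt in the form of
Darmon–Diamond–Taylor Prop. 2.6(b); Katz 1981 Thm. 2), and read `a_ℓ = W₀.frobeniusTrace ℓ` off
the `L`-function (`LFunction_apply_prime_eq_frobeniusTrace`, Silverman AEC Ex. 8.19(a)); the good
prime `ℓ` does not divide `N_E` (`not_dvd_conductorNorm_of_hasGoodReductionAtPrime`).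
[cite: DarmonDiamondTaylor1995, Prop. 2.6(b) (PDF p. 53)] -/
theorem exists_prime_not_dvd_lFunction_sub_of_hasIrreducibleModPGaloisRep (W : WeierstrassCurve ℚ)
    [W.IsElliptic] (p : ℕ) [Fact p.Prime] (hirr : W.HasIrreducibleModPGaloisRep p) :
    ∃ ℓ : ℕ, ℓ.Prime ∧ ℓ ≠ p ∧ ¬ ℓ ∣ W.conductorNorm ℤ ∧ ¬ (p : ℤ) ∣ W.LFunction ℓ - (ℓ + 1) := by
  obtain ⟨C, hC⟩ := hasGlobalMinimalModel_rat_holds W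
  haveI := hC
  have hirr₀ : (C • W).HasIrreducibleModPGaloisRep p :=
    (Mazur1978.hasIrreducibleModPGaloisRep_smul_iff W C p).mpr hirr
  obtain ⟨ℓ, hℓ, hℓp, hgood, hne⟩ :=
    exists_prime_not_dvd_frobeniusTrace_sub not_irreducible_of_frobeniusTrace_congr_holds (C • W) p
      hirr₀
  refine ⟨ℓ, hℓ.out, hℓp, ?_, ?_⟩
  · rw [← conductorNorm_smul ℤ W C]
    exact not_dvd_conductorNorm_of_hasGoodReductionAtPrime (C • W) hgood
  · rwa [← LFunction_smul W C, LFunction_apply_prime_eq_frobeniusTrace (C • W) ℓ hgood]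

/-- **Hypothesis CR (i) of Pollack–Weston gives a non-Eisenstein good prime**: if
`ρ̄_{E,p} : Γ_ℚ → GL₂(𝔽_p)` is surjective (`HasSurjectiveModNGaloisRep`, PW 2011 Introduction,
CR (i)), there is a prime `ℓ ≠ p`, `ℓ ∤ N_E`, with `a_ℓ(E) ≢ ℓ + 1 (mod p)` — the maximal ideal
`𝔪_f = (p, T_ℓ - a_ℓ(E) : ℓ ∤ N_E)` of the Hecke algebra is not Eisenstein, the form in which CR (i)
enters Prop. 6.3 (2) / 6.4 (1) of the proof of Thm. 6.8. From
`exists_prime_not_dvd_lFunction_sub_of_hasIrreducibleModPGaloisRep` and surjective ⇒ irreducible.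
[cite: PollackWeston2011, Introduction (hypothesis CR) and Prop. 6.3] -/
theorem exists_prime_not_dvd_lFunction_sub_of_hasSurjectiveModNGaloisRep (W : WeierstrassCurve ℚ)
    [W.IsElliptic] (p : ℕ) [Fact p.Prime] (hsurj : W.HasSurjectiveModNGaloisRep (p : ℤ)) :
    ∃ ℓ : ℕ, ℓ.Prime ∧ ℓ ≠ p ∧ ¬ ℓ ∣ W.conductorNorm ℤ ∧ ¬ (p : ℤ) ∣ W.LFunction ℓ - (ℓ + 1) := by
  haveI : NeZero (p : ℚ) := ⟨Nat.cast_ne_zero.mpr (Fact.out : p.Prime).ne_zero⟩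
  exact exists_prime_not_dvd_lFunction_sub_of_hasIrreducibleModPGaloisRep W p
    (hasIrreducibleModPGaloisRep_of_hasSurjectiveModNGaloisRep W p hsurj)

end Literature.NumberTheory.EllipticCurves

end
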